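import Mathlib
import Summits.MatrixMultiplication.MatrixMultiplication.Theses.FourierTwoFamiliesModP
import Summits.MatrixMultiplication.MatrixMultiplication.Theorems.FourierTwoFamiliesModPPrimeCyclicPowerGainStubFamilyPoint
import Summits.MatrixMultiplication.MatrixMultiplication.Theorems.FourierTwoFamiliesModPPrimeCyclicPowerGainStubAverage
import Summits.MatrixMultiplication.MatrixMultiplication.Theorems.FourierTwoFamiliesModPPrimeCyclicPowerGainThetaFrequencyBias
import Summits.MatrixMultiplication.MatrixMultiplication.Theorems.FourierTwoFamiliesModPPrimeLogDecayStubThetaDegreeOne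

/-!
# `PrimeLogDecay` from the theta log-bound on the structured branch (the composition of the line)

Crux `stmt-MatrixMultiplication-14310` (`FourierTwoFamiliesModP.PrimeLogDecay`), line
`fixed-delta-theta-certificate`: the kernel-checked COMPOSITION of the line, landed as a conditional theorem
`stub_primeLogDecay_of_thetaLogBoundNoCert` (registered as stub `stub_primeLogDecay_of_thetaLogBoundNoCert` via `stub-add`; the registered skeleton's
`PrimeLogDecay_of` is this proof with the bet invoked by name).  Its hypothesis is, verbatim, the line's one open registered stub
`stub_thetaLogBoundNoCert` (THE BET: every translation-invariant feasible kernel of the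
frozen-difference compatibility graph of a frozen set `X₀ ⊆ ℤ/p` WITHOUT a degree-one certificate of quality
`(log s)^c` has value `≤ p/(s (log s)^c)`); its conclusion is the crux `PrimeLogDecay` by name.  So the crux is
closed modulo the bet, durably: when the bet lands as `T`, `stub_primeLogDecay_of_thetaLogBoundNoCert T` closes
the item.

Proof (all ingredients landed).  Given a balanced SDPP family `(A i, B i)_{i < n}` in `ℤ/p` with (W), (X):
freeze `Δ = ⋃ⱼ (A j − B j)`; clause (X) says the `n` blocks are pairwise COMPATIBLE vertices of `G_Δ`
(`cross_disjoint`) and distinct (`blocks_injective`).  Every translation-invariant feasible kernel on `G_Δ` has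
value `≤ p/(s (log s)^c)`: if `Δ` carries a degree-one certificate `F` of quality `(log s)^c`, by the landed
`DegreeOne.stub_thetaDegreeOne` (`s X ΣF ≤ s p + M (p − s X)` with `ΣF ≥ (s + M)(log s)^c`); otherwise by the
bet, whose `ϑ`-FrequencyBias hypothesis schema is discharged by the landed sibling theorem
`FrequencyBias.stub_thetaFrequencyBias`.  Admissibility and compatibility are translation invariant
(`support_vadd_iff`), so the landed symmetrisation `Average.stub_average` removes the invariance hypothesis, and
the landed `FamilyPoint.stub_familyPoint` (the family's normalised Gram kernel is feasible with value `n`) gives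
`n ≤ p/(s (log s)^c)`, i.e. `n · s · (log s)^c ≤ p`.
-/

namespace Summit.MatrixMultiplication.MatrixMultiplication.Theorems.PrimeLogDecayTheta.Composition

open Finset
open scoped Pointwise BigOperators
open Summit.MatrixMultiplication.MatrixMultiplication.Theses.FourierTwoFamiliesModP (PrimeLogDecay)
open Summit.MatrixMultiplication.MatrixMultiplication.Theorems.PrimeCyclicPowerGainTheta
open Summit.MatrixMultiplication.MatrixMultiplication.Theorems.PrimeLogDecayTheta

/-! ## Proved glue (i): the SDPP family is a set of pairwise compatible vertices of `G_Δ` -/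

/-- Clause (X) says the cross differences `A i − B k` (`i ≠ k`) avoid the matched difference set
`Δ = ⋃ⱼ (A j − B j)` (the card's PairwiseForm / F0). -/
theorem cross_disjoint {p n : ℕ} (A B : Fin n → Finset (ZMod p))
    (hX : ∀ i j k : Fin n, ∀ a ∈ A i, ∀ a' ∈ A j, ∀ b ∈ B j, ∀ b' ∈ B k,
      (a - a') + (b - b') = 0 → i = k)
    {i k : Fin n} (hik : i ≠ k) :
    Disjoint (A i - B k) (Finset.univ.biUnion fun j => A j - B j) := by
  rw [Finset.disjoint_left]
  intro x hx hx'
  rw [Finset.mem_sub] at hx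
  obtain ⟨a, ha, b', hb', rfl⟩ := hx
  rw [Finset.mem_biUnion] at hx'
  obtain ⟨j, -, hj⟩ := hx'
  rw [Finset.mem_sub] at hj
  obtain ⟨a', ha', b, hb, h⟩ := hj
  have h0 : (a - a') + (b - b') = 0 := by
    linear_combination -h
  exact hik (hX i j k a ha a' ha' b hb b' hb' h0)

/-- Distinct indices carry distinct blocks (from (X) with `j = k` and non-emptiness). -/
theorem blocks_injective {p n s : ℕ} (A B : Fin n → Finset (ZMod p)) (hs : 1 ≤ s)
    (hcard : ∀ i : Fin n, (A i).card = s ∧ (B i).card = s)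
    (hX : ∀ i j k : Fin n, ∀ a ∈ A i, ∀ a' ∈ A j, ∀ b ∈ B j, ∀ b' ∈ B k,
      (a - a') + (b - b') = 0 → i = k) :
    Function.Injective (fun i => (A i, B i)) := by
  intro i k hik
  simp only [Prod.mk.injEq] at hik
  obtain ⟨hA, hB⟩ := hik
  have hneA : (A i).Nonempty := by
    rw [← Finset.card_pos]; have := (hcard i).1; omega
  have hneB : (B i).Nonempty := by
    rw [← Finset.card_pos]; have := (hcard i).2; omega
  obtain ⟨a, ha⟩ := hneA
  obtain ⟨b, hb⟩ := hneB
  exact hX i k k a ha a (hA ▸ ha) b (hB ▸ hb) b (hB ▸ hb) (by simp)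

/-! ## Proved glue (ii): admissibility and compatibility are translation invariant -/

section Invariance

variable {p : ℕ}

/-- clause (W) for a block is invariant under translating both sides by `t`. -/
theorem dpp_vadd_iff (t : ZMod p) (A B : Finset (ZMod p)) :
    (∀ a ∈ t +ᵥ A, ∀ a' ∈ t +ᵥ A, ∀ b ∈ t +ᵥ B, ∀ b' ∈ t +ᵥ B,
        (a - a') + (b - b') = 0 → a = a' ∧ b = b') ↔
    (∀ a ∈ A, ∀ a' ∈ A, ∀ b ∈ B, ∀ b' ∈ B, (a - a') + (b - b') = 0 → a = a' ∧ b = b') := by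
  constructor
  · intro h a ha a' ha' b hb b' hb' h0
    have h1 := h (t +ᵥ a) ((Finset.vadd_mem_vadd_finset_iff t).mpr ha) (t +ᵥ a')
      ((Finset.vadd_mem_vadd_finset_iff t).mpr ha') (t +ᵥ b)
      ((Finset.vadd_mem_vadd_finset_iff t).mpr hb)
      (t +ᵥ b') ((Finset.vadd_mem_vadd_finset_iff t).mpr hb')
      (by simp only [vadd_eq_add]; linear_combination h0)
    simp only [vadd_eq_add, add_right_inj] at h1
    exact h1
  · intro h x hx x' hx' y hy y' hy' h0
    rw [Finset.mem_vadd_finset] at hx hx' hy hy'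
    obtain ⟨a, ha, rfl⟩ := hx
    obtain ⟨a', ha', rfl⟩ := hx'
    obtain ⟨b, hb, rfl⟩ := hy
    obtain ⟨b', hb', rfl⟩ := hy'
    have h1 := h a ha a' ha' b hb b' hb'
      (by simp only [vadd_eq_add] at h0; linear_combination h0)
    obtain ⟨rfl, rfl⟩ := h1
    exact ⟨rfl, rfl⟩

/-- difference sets are invariant: `(t +ᵥ A) − (t +ᵥ B) = A − B`. -/
theorem vadd_sub_vadd (t : ZMod p) (A B : Finset (ZMod p)) :
    (t +ᵥ A) - (t +ᵥ B) = A - B := by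
  ext x
  simp only [Finset.mem_sub, Finset.mem_vadd_finset]
  constructor
  · rintro ⟨_, ⟨a, ha, rfl⟩, _, ⟨b, hb, rfl⟩, rfl⟩
    exact ⟨a, ha, b, hb, by simp only [vadd_eq_add]; abel⟩
  · rintro ⟨a, ha, b, hb, rfl⟩
    exact ⟨t +ᵥ a, ⟨a, ha, rfl⟩, t +ᵥ b, ⟨b, hb, rfl⟩, by simp only [vadd_eq_add]; abel⟩

/-- admissibility of a vertex `v = (A, B)` for `X₀` is translation invariant. -/
theorem adm_vadd_iff (s : ℕ) (X₀ : Finset (ZMod p)) (t : ZMod p)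
    (v : Finset (ZMod p) × Finset (ZMod p)) :
    ((t +ᵥ v).1.card = s ∧ (t +ᵥ v).2.card = s ∧
        (∀ a ∈ (t +ᵥ v).1, ∀ a' ∈ (t +ᵥ v).1, ∀ b ∈ (t +ᵥ v).2, ∀ b' ∈ (t +ᵥ v).2,
            (a - a') + (b - b') = 0 → a = a' ∧ b = b') ∧
        (t +ᵥ v).1 - (t +ᵥ v).2 ⊆ X₀) ↔
    (v.1.card = s ∧ v.2.card = s ∧
        (∀ a ∈ v.1, ∀ a' ∈ v.1, ∀ b ∈ v.2, ∀ b' ∈ v.2,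
            (a - a') + (b - b') = 0 → a = a' ∧ b = b') ∧
        v.1 - v.2 ⊆ X₀) := by
  rw [Prod.vadd_fst, Prod.vadd_snd, Finset.card_vadd_finset, Finset.card_vadd_finset,
    dpp_vadd_iff, vadd_sub_vadd]

/-- compatibility of two vertices is translation invariant. -/
theorem compat_vadd_iff (X₀ : Finset (ZMod p)) (t : ZMod p)
    (v w : Finset (ZMod p) × Finset (ZMod p)) :
    (t +ᵥ v = t +ᵥ w ∨
        (Disjoint ((t +ᵥ v).1 - (t +ᵥ w).2) X₀ ∧ Disjoint ((t +ᵥ w).1 - (t +ᵥ v).2) X₀)) ↔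
    (v = w ∨ (Disjoint (v.1 - w.2) X₀ ∧ Disjoint (w.1 - v.2) X₀)) := by
  rw [Prod.vadd_fst, Prod.vadd_snd, Prod.vadd_fst, Prod.vadd_snd, vadd_sub_vadd, vadd_sub_vadd,
    (AddAction.injective t).eq_iff]

/-- the whole support predicate of the relaxation is translation invariant. -/
theorem support_vadd_iff (s : ℕ) (X₀ : Finset (ZMod p)) (t : ZMod p)
    (v w : Finset (ZMod p) × Finset (ZMod p)) :
    ((((t +ᵥ v).1.card = s ∧ (t +ᵥ v).2.card = s ∧
          (∀ a ∈ (t +ᵥ v).1, ∀ a' ∈ (t +ᵥ v).1, ∀ b ∈ (t +ᵥ v).2, ∀ b' ∈ (t +ᵥ v).2,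
              (a - a') + (b - b') = 0 → a = a' ∧ b = b') ∧
          (t +ᵥ v).1 - (t +ᵥ v).2 ⊆ X₀) ∧
        ((t +ᵥ w).1.card = s ∧ (t +ᵥ w).2.card = s ∧
          (∀ a ∈ (t +ᵥ w).1, ∀ a' ∈ (t +ᵥ w).1, ∀ b ∈ (t +ᵥ w).2, ∀ b' ∈ (t +ᵥ w).2,
              (a - a') + (b - b') = 0 → a = a' ∧ b = b') ∧
          (t +ᵥ w).1 - (t +ᵥ w).2 ⊆ X₀) ∧
        (t +ᵥ v = t +ᵥ w ∨
          (Disjoint ((t +ᵥ v).1 - (t +ᵥ w).2) X₀ ∧ Disjoint ((t +ᵥ w).1 - (t +ᵥ v).2) X₀))) ↔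
      ((v.1.card = s ∧ v.2.card = s ∧
          (∀ a ∈ v.1, ∀ a' ∈ v.1, ∀ b ∈ v.2, ∀ b' ∈ v.2,
              (a - a') + (b - b') = 0 → a = a' ∧ b = b') ∧
          v.1 - v.2 ⊆ X₀) ∧
        (w.1.card = s ∧ w.2.card = s ∧
          (∀ a ∈ w.1, ∀ a' ∈ w.1, ∀ b ∈ w.2, ∀ b' ∈ w.2,
              (a - a') + (b - b') = 0 → a = a' ∧ b = b') ∧
          w.1 - w.2 ⊆ X₀) ∧
        (v = w ∨ (Disjoint (v.1 - w.2) X₀ ∧ Disjoint (w.1 - v.2) X₀)))) := by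
  rw [adm_vadd_iff, adm_vadd_iff, compat_vadd_iff]

end Invariance

/-! ## The composition -/

/-- **`stub_primeLogDecay_of_thetaLogBoundNoCert`** (crux stmt-MatrixMultiplication-14310, line
fixed-delta-theta-certificate; the line's composition as a conditional theorem): the registered bet
`stub_thetaLogBoundNoCert` — stated verbatim as the hypothesis — implies the crux `PrimeLogDecay`. -/
theorem stub_primeLogDecay_of_thetaLogBoundNoCert :
    (∃ c : ℝ, 0 < c ∧ ∃ s₀ : ℕ, ∀ (p : ℕ) [Fact p.Prime] (s : ℕ), s₀ ≤ s →
        ∀ X₀ : Finset (ZMod p),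
        (∀ (F : ZMod p → ℝ) (M : ℝ), 0 ≤ M → (∀ x ∈ X₀, F x ≤ 1) → (∀ x, x ∉ X₀ → F x ≤ 0) →
            (∀ ψ : AddChar (ZMod p) ℂ, ψ ≠ 1 → ‖∑ x, (F x : ℂ) * ψ x‖ ≤ M) →
            ∑ x, F x < ((s : ℝ) + M) * Real.log (s : ℝ) ^ c) →
        ∀ B : Finset (ZMod p) × Finset (ZMod p) → Finset (ZMod p) × Finset (ZMod p) → ℝ,
          (∀ (t : ZMod p) (v w : Finset (ZMod p) × Finset (ZMod p)), B (t +ᵥ v) (t +ᵥ w) = B v w) →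
          (∀ v w, B v w = B w v) →
          (∀ x : Finset (ZMod p) × Finset (ZMod p) → ℝ, 0 ≤ ∑ v, ∑ w, x v * B v w * x w) →
          (∀ v w, 0 ≤ B v w) →
          (∀ v w, B v w ≤ B v v) →
          (∀ v w : Finset (ZMod p) × Finset (ZMod p), B v w ≠ 0 →
              (v.1.card = s ∧ v.2.card = s ∧
                (∀ a ∈ v.1, ∀ a' ∈ v.1, ∀ b ∈ v.2, ∀ b' ∈ v.2,
                    (a - a') + (b - b') = 0 → a = a' ∧ b = b') ∧
                v.1 - v.2 ⊆ X₀) ∧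
              (w.1.card = s ∧ w.2.card = s ∧
                (∀ a ∈ w.1, ∀ a' ∈ w.1, ∀ b ∈ w.2, ∀ b' ∈ w.2,
                    (a - a') + (b - b') = 0 → a = a' ∧ b = b') ∧
                w.1 - w.2 ⊆ X₀) ∧
              (v = w ∨ (Disjoint (v.1 - w.2) X₀ ∧ Disjoint (w.1 - v.2) X₀))) →
          ∑ v, B v v = 1 →
          (∀ M : ℝ, 0 ≤ M →
            (∀ ψ : AddChar (ZMod p) ℂ, ψ ≠ 1 →
              ‖∑ v, (B v v : ℂ) * ∑ a ∈ v.1, ∑ b ∈ v.2, ψ (a - b)‖ ≤ M) →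
            (s : ℝ) ^ 2 * ((s : ℝ) ^ 2 * (∑ v, ∑ w, B v w) - (p : ℝ)) ≤
              M * ((p : ℝ) * (s : ℝ) - (s : ℝ) ^ 2 * ∑ v, ∑ w, B v w)) →
          (s : ℝ) * Real.log (s : ℝ) ^ c * ∑ v, ∑ w, B v w ≤ (p : ℝ)) →
      Summit.MatrixMultiplication.MatrixMultiplication.Theses.FourierTwoFamiliesModP.PrimeLogDecay := by
  intro hBet
  obtain ⟨c, hc, s₀, hbet⟩ := hBet
  refine ⟨c, hc, max s₀ 2, ?_⟩
  intro p hp n s A B hs hcard hW hX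
  haveI : Fact p.Prime := ⟨hp⟩
  have hs₀ : s₀ ≤ s := le_trans (le_max_left _ _) hs
  have hs2 : 2 ≤ s := le_trans (le_max_right _ _) hs
  have hs1 : 1 ≤ s := le_trans (by norm_num) hs2
  have hsR : (0 : ℝ) < s := by exact_mod_cast (show 0 < s by omega)
  have hlog : 0 < Real.log (s : ℝ) := Real.log_pos (by exact_mod_cast (show 1 < s by omega))
  have hLpos : 0 < Real.log (s : ℝ) ^ c := Real.rpow_pos_of_pos hlog c
  have hsL : 0 < (s : ℝ) * Real.log (s : ℝ) ^ c := mul_pos hsR hLpos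
  have hTnn : 0 ≤ (p : ℝ) / ((s : ℝ) * Real.log (s : ℝ) ^ c) :=
    div_nonneg (Nat.cast_nonneg _) hsL.le
  -- Step 1: every translation-invariant feasible kernel on `G_Δ` has value `≤ p / (s (log s)^c)`
  have hinv : ∀ Bk : Finset (ZMod p) × Finset (ZMod p) → Finset (ZMod p) × Finset (ZMod p) → ℝ,
      (∀ (t : ZMod p) (v w : Finset (ZMod p) × Finset (ZMod p)), Bk (t +ᵥ v) (t +ᵥ w) = Bk v w) →
      (∀ v w, Bk v w = Bk w v) →
      (∀ x : Finset (ZMod p) × Finset (ZMod p) → ℝ, 0 ≤ ∑ v, ∑ w, x v * Bk v w * x w) →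
      (∀ v w, 0 ≤ Bk v w) →
      (∀ v w, Bk v w ≤ Bk v v) →
      (∀ v w : Finset (ZMod p) × Finset (ZMod p), Bk v w ≠ 0 →
          (v.1.card = s ∧ v.2.card = s ∧
            (∀ a ∈ v.1, ∀ a' ∈ v.1, ∀ b ∈ v.2, ∀ b' ∈ v.2,
                (a - a') + (b - b') = 0 → a = a' ∧ b = b') ∧
            v.1 - v.2 ⊆ Finset.univ.biUnion fun j => A j - B j) ∧
          (w.1.card = s ∧ w.2.card = s ∧
            (∀ a ∈ w.1, ∀ a' ∈ w.1, ∀ b ∈ w.2, ∀ b' ∈ w.2,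
                (a - a') + (b - b') = 0 → a = a' ∧ b = b') ∧
            w.1 - w.2 ⊆ Finset.univ.biUnion fun j => A j - B j) ∧
          (v = w ∨ (Disjoint (v.1 - w.2) (Finset.univ.biUnion fun j => A j - B j) ∧
            Disjoint (w.1 - v.2) (Finset.univ.biUnion fun j => A j - B j)))) →
      ∑ v, Bk v v = 1 →
      ∑ v, ∑ w, Bk v w ≤ (p : ℝ) / ((s : ℝ) * Real.log (s : ℝ) ^ c) := by
    intro Bk hinvk hsymm hpsd hnn hdom hsupp htr
    have hXnn : 0 ≤ ∑ v, ∑ w, Bk v w :=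
      Finset.sum_nonneg fun v _ => Finset.sum_nonneg fun w _ => hnn v w
    rw [le_div_iff₀ hsL]
    by_cases hU : ∃ (F : ZMod p → ℝ) (M : ℝ), 0 ≤ M ∧
        (∀ x ∈ (Finset.univ.biUnion fun j => A j - B j), F x ≤ 1) ∧
        (∀ x, x ∉ (Finset.univ.biUnion fun j => A j - B j) → F x ≤ 0) ∧
        (∀ ψ : AddChar (ZMod p) ℂ, ψ ≠ 1 → ‖∑ x, (F x : ℂ) * ψ x‖ ≤ M) ∧
        ((s : ℝ) + M) * Real.log (s : ℝ) ^ c ≤ ∑ x, F x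
    · -- uniform branch: a degree-one certificate `F` exists
      obtain ⟨F, M, hM, hF1, hF0, hFhat, hqual⟩ := hU
      have h1 := DegreeOne.stub_thetaDegreeOne (ZMod p) s hs1 (Finset.univ.biUnion fun j => A j - B j) Bk F M
        hsymm hpsd hnn hsupp htr hM hF1 hF0 hFhat
      rw [ZMod.card p] at h1
      -- h1 : s·X·ΣF ≤ s·p + M·(p − s·X);  hqual : (s + M)·(log s)^c ≤ ΣF
      have hsM : 0 < (s : ℝ) + M := by linarith
      have hA : (s : ℝ) * (∑ v, ∑ w, Bk v w) * (((s : ℝ) + M) * Real.log (s : ℝ) ^ c) ≤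
          (s : ℝ) * (∑ v, ∑ w, Bk v w) * ∑ x, F x :=
        mul_le_mul_of_nonneg_left hqual (mul_nonneg hsR.le hXnn)
      have hB : (s : ℝ) * (∑ v, ∑ w, Bk v w) * (∑ x, F x) ≤ ((s : ℝ) + M) * (p : ℝ) := by
        have hMsX : 0 ≤ M * ((s : ℝ) * ∑ v, ∑ w, Bk v w) := mul_nonneg hM (mul_nonneg hsR.le hXnn)
        nlinarith [h1, hMsX]
      have hC : ((s : ℝ) + M) * ((∑ v, ∑ w, Bk v w) * ((s : ℝ) * Real.log (s : ℝ) ^ c)) ≤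
          ((s : ℝ) + M) * (p : ℝ) := by
        have e : ((s : ℝ) + M) * ((∑ v, ∑ w, Bk v w) * ((s : ℝ) * Real.log (s : ℝ) ^ c)) =
            (s : ℝ) * (∑ v, ∑ w, Bk v w) * (((s : ℝ) + M) * Real.log (s : ℝ) ^ c) := by ring
        rw [e]
        exact hA.trans hB
      exact le_of_mul_le_mul_left hC hsM
    · -- structured branch (no degree-one certificate): the bet, fed by `ϑ`-FrequencyBias
      push Not at hU
      have h2 : ∀ M : ℝ, 0 ≤ M →
          (∀ ψ : AddChar (ZMod p) ℂ, ψ ≠ 1 →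
            ‖∑ v, (Bk v v : ℂ) * ∑ a ∈ v.1, ∑ b ∈ v.2, ψ (a - b)‖ ≤ M) →
          (s : ℝ) ^ 2 * ((s : ℝ) ^ 2 * (∑ v, ∑ w, Bk v w) - (p : ℝ)) ≤
            M * ((p : ℝ) * (s : ℝ) - (s : ℝ) ^ 2 * ∑ v, ∑ w, Bk v w) := by
        intro M hM hMb
        have h := FrequencyBias.stub_thetaFrequencyBias (ZMod p) s hs1 (Finset.univ.biUnion fun j => A j - B j)
          Bk M hsymm hpsd hsupp htr hM hMb
        rwa [ZMod.card p] at h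
      have key := hbet p s hs₀ (Finset.univ.biUnion fun j => A j - B j) hU Bk hinvk hsymm hpsd hnn
        hdom hsupp htr h2
      calc (∑ v, ∑ w, Bk v w) * ((s : ℝ) * Real.log (s : ℝ) ^ c)
          = (s : ℝ) * Real.log (s : ℝ) ^ c * ∑ v, ∑ w, Bk v w := by ring
        _ ≤ (p : ℝ) := key
  -- Step 2: symmetrisation removes the invariance hypothesis (landed `stub_average`)
  have key := Average.stub_average p (Finset (ZMod p) × Finset (ZMod p)) _ _
    (fun t v w => support_vadd_iff s (Finset.univ.biUnion fun j => A j - B j) t v w) hinv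
  -- Step 3: the family as a finset of pairwise compatible vertices (landed `stub_familyPoint`)
  have hFinj : Function.Injective (fun i => (A i, B i)) := blocks_injective A B hs1 hcard hX
  have hScard : (Finset.univ.image fun i => (A i, B i)).card = n := by
    rw [Finset.card_image_of_injective _ hFinj, Finset.card_univ, Fintype.card_fin]
  have hP : ∀ v ∈ (Finset.univ.image fun i => (A i, B i)),
      ∀ w ∈ (Finset.univ.image fun i => (A i, B i)),
        ((v.1.card = s ∧ v.2.card = s ∧
            (∀ a ∈ v.1, ∀ a' ∈ v.1, ∀ b ∈ v.2, ∀ b' ∈ v.2,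
                (a - a') + (b - b') = 0 → a = a' ∧ b = b') ∧
            v.1 - v.2 ⊆ Finset.univ.biUnion fun j => A j - B j) ∧
          (w.1.card = s ∧ w.2.card = s ∧
            (∀ a ∈ w.1, ∀ a' ∈ w.1, ∀ b ∈ w.2, ∀ b' ∈ w.2,
                (a - a') + (b - b') = 0 → a = a' ∧ b = b') ∧
            w.1 - w.2 ⊆ Finset.univ.biUnion fun j => A j - B j) ∧
          (v = w ∨ (Disjoint (v.1 - w.2) (Finset.univ.biUnion fun j => A j - B j) ∧
            Disjoint (w.1 - v.2) (Finset.univ.biUnion fun j => A j - B j)))) := by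
    intro v hv w hw
    rw [Finset.mem_image] at hv hw
    obtain ⟨i, -, rfl⟩ := hv
    obtain ⟨k, -, rfl⟩ := hw
    refine ⟨⟨(hcard i).1, (hcard i).2, hW i, ?_⟩, ⟨(hcard k).1, (hcard k).2, hW k, ?_⟩, ?_⟩
    · exact Finset.subset_biUnion_of_mem (fun j => A j - B j) (Finset.mem_univ i)
    · exact Finset.subset_biUnion_of_mem (fun j => A j - B j) (Finset.mem_univ k)
    · by_cases hik : i = k
      · subst hik; exact Or.inl rfl
      · exact Or.inr ⟨cross_disjoint A B hX hik, cross_disjoint A B hX (Ne.symm hik)⟩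
  have hn : (n : ℝ) ≤ (p : ℝ) / ((s : ℝ) * Real.log (s : ℝ) ^ c) := by
    have h := FamilyPoint.stub_familyPoint (Finset (ZMod p) × Finset (ZMod p)) _ _ _ hTnn hP key
    rwa [hScard] at h
  have hfin := (le_div_iff₀ hsL).mp hn
  calc (n : ℝ) * (s : ℝ) * Real.log (s : ℝ) ^ c = (n : ℝ) * ((s : ℝ) * Real.log (s : ℝ) ^ c) := by ring
    _ ≤ (p : ℝ) := hfin

end Summit.MatrixMultiplication.MatrixMultiplication.Theorems.PrimeLogDecayTheta.Composition
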